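import Literature.NumberTheory.EllipticCurves.TwoDescentLocalPadic
import HarnessLib

/-!
# The `3`-adic normal form `y² + a₁xy + a₃y = x³` of a curve with a rational `3`-torsion point, I:
# `v₃(Δ) = 3 ∧ 3 ∣ c₄` pins `a₃ ∈ ℤ₃^×`, `3 ∣ a₁`, and then EVERY affine `y` (`x ≠ 0`) is FLAT, `3 ∣ v₃(y)`
# (cell `b2b-bsdres`; seat `b2b-bsdres-x11b3-p7` GEN 13 as CROSS-CELL POOL HAND on o5-r1 GEN 12's ask
#  'x11b3: T29.6' — the flat half of the EVIDENCE law T29.6 `O5.FlatKummerImageTypeIIIThree` of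
#  `HOME/b2b-bsdres-o5-r1/gen12/O5RationalTorsionCostLaw.lean` (typing A-O5-27, cc-typer-5); TOOL, theorems only)

HONEST FRAMING (cell `b2b-bsdres`, run/shared/lean/b2b/bsd-rank1-residual/, verbatim in every file): the
goal of the cell is to DELETE the COMBINATION-SHAPED residual classes of the Birch–Swinnerton-Dyer formula
for ALL analytic-rank `≤ 1` elliptic curves over `ℚ` — "full BSD formula for every rank `≤ 1` curve in
class `C`" assembled STRICTLY from published theorems — so that the rank-`≤ 1` remainder becomes exactly
the CONSTRUCTION-SHAPED classes, which are TYPED (missing-input `Prop`s), NOT attempted. This is not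
"finishing BSD". Lane CLASS-CLOSURE / teams o5–o6 (O5 OPEN): research routes; census output is
EVIDENCE, never a Literature fact; nothing is booked; no mark of `RESIDUAL-MAP.md` moves. This file:
THEOREMS ONLY (no definition, no named fact, no `@[conjecture]` node, no `sorry`; net named-fact debt
`0`). It proves NOTHING about any elliptic curve, Kodaira symbol, conductor or Selmer group: pure
`3`-adic algebra about the one cubic equation `y² + a₁xy + a₃y = x³` over `ℚ₃`.

## Why this normal form (the reading is the O5 lane's, not asserted here)

If `P₀ = (x₀, y₀)` is a point of exact order `3` of a Weierstrass curve `W/ℚ₃`, the change of variables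
`(u, r, s, t) = (1, x₀, m₀, y₀)` (`m₀` the tangent slope at `P₀`) produces `Y² + a₁'XY + a₃'Y = X³`
(`a₆' = 0`: `P₀` on the curve; `a₄' = 0`: tangent horizontal; `a₂' = Ψ₃(x₀)/a₃'² = 0`: flex), with
`Y = y − y₀ − m₀(x − x₀)` = o5-r1's `tangentValueAtThree` LITERALLY and `Δ, c₄, c₆` unchanged; here
`Δ = a₃'³(a₁'³ − 27a₃')`, `c₄ = a₁'(a₁'³ − 24a₃')`.  That step (and the Table-II row extraction giving
`3 ∣ c₄` from `f₃ = 2`, `v₃Δ = 3`, as in `Additive/SelectorIdentityTameThreeProofs.lean`) is NOT in this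
file; this file is the algebra downstream of it.

## What is proved (all `[folklore]`)

* §1: norm ↔ valuation bookkeeping on `ℚ_p` (`‖y‖ < ‖x‖ ↔ v x < v y`, the strict ultrametric
  equality `v(x + y) = v(x)` when `‖y‖ < ‖x‖`, `‖x‖ < 1 ↔ x = 0 ∨ 1 ≤ v x`, `‖x‖ = 1 ↔ x ≠ 0 ∧ v x = 0`,
  `1 < ‖x‖ ↔ v x < 0`), complementing the tree's `TwoDescentLocal.valuation_add_eq_left_of_lt` /
  `valuation_neg'` (`Literature/…/TwoDescentLocalPadic.lean`), which are reused.
* §2 **`norm_a₃_eq_one_and_norm_a₁_lt_one`** (END-1): `a₃ ≠ 0`, `v₃(a₃³(a₁³ − 27a₃)) = 3` and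
  `‖a₁(a₁³ − 24a₃)‖ < 1` force `‖a₃‖ = 1 ∧ ‖a₁‖ < 1` — a three-case valuation analysis
  (`v(a₁³) <, =, > v(27a₃)`); NO integrality of `a₁, a₃` is assumed (so no "torsion points are integral"
  lemma is needed upstream).
* §3 **`ne_zero_and_three_dvd_valuation`** (END-2, the FLAT half): if `‖a₃‖ = 1`, `‖a₁‖ ≤ 1`,
  `y² + a₁xy + a₃y = x³` and `x ≠ 0`, then `y ≠ 0 ∧ 3 ∣ v₃(y)` — the body of o5-r1's
  `IsFlatClassAtThree y` verbatim — by bookkeeping on `y(y + a₁x + a₃) = x³` (Kodaira II or III alike).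
The UNIT half (a point whose `y` is a flat NON-cube) and the Table-II residue criterion are the sibling
file `O5/ThreeTorsionNormalFormKummer.lean`.

References: J. H. Silverman, *The Arithmetic of Elliptic Curves*, X.4 (descent via `3`-isogeny: the
Kummer map is the tangent-line value modulo cubes — the reading, not used here); o5-r1 GEN 12,
`T29-RATIONAL-TORSION-COST-LAW.md` §3 (law T29.6, EVIDENCE 2 251/2 251, kit j141165).
-/

noncomputable section

open Padic
open Literature.NumberTheory.EllipticCurves.TwoDescentLocal (valuation_neg' valuation_add_eq_left_of_lt)

namespace Summit.BirchSwinnertonDyer.Rank1Residual.O5.ThreeTorsionNormalForm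

/-! ## §1 Valuation bookkeeping on `ℚ_[p]` -/

section Valuation

variable {p : ℕ} [hp : Fact p.Prime]

/-- For non-zero `x, y ∈ ℚ_p`: `‖y‖ < ‖x‖ ↔ v(x) < v(y)`. [folklore] -/
theorem norm_lt_norm_iff_valuation_lt {x y : ℚ_[p]} (hx : x ≠ 0) (hy : y ≠ 0) :
    ‖y‖ < ‖x‖ ↔ x.valuation < y.valuation := by
  rw [Padic.norm_eq_zpow_neg_valuation hx, Padic.norm_eq_zpow_neg_valuation hy,
    zpow_lt_zpow_iff_right₀ (by exact_mod_cast hp.out.one_lt)]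
  omega

/-- For non-zero `x, y ∈ ℚ_p`: `‖y‖ = ‖x‖ ↔ v(x) = v(y)`. [folklore] -/
theorem norm_eq_norm_iff_valuation_eq {x y : ℚ_[p]} (hx : x ≠ 0) (hy : y ≠ 0) :
    ‖y‖ = ‖x‖ ↔ x.valuation = y.valuation := by
  have h1 : (1 : ℝ) < p := by exact_mod_cast hp.out.one_lt
  rw [Padic.norm_eq_zpow_neg_valuation hx, Padic.norm_eq_zpow_neg_valuation hy,
    (zpow_right_injective₀ (zero_lt_one.trans h1) h1.ne').eq_iff]
  omega

/-- The strict ultrametric equality: if `‖y‖ < ‖x‖` then `x + y ≠ 0` and `v(x + y) = v(x)`. [folklore] -/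
theorem add_ne_zero_and_valuation_add_eq_of_norm_lt {x y : ℚ_[p]} (h : ‖y‖ < ‖x‖) :
    x + y ≠ 0 ∧ (x + y).valuation = x.valuation := by
  have hx : x ≠ 0 := by
    rintro rfl
    exact (norm_nonneg y).not_gt (by simpa using h)
  have hxy : ‖x + y‖ = ‖x‖ := by
    rw [Padic.add_eq_max_of_ne (ne_of_gt h), max_eq_left h.le]
  have hne : x + y ≠ 0 := by
    intro h0
    rw [h0, norm_zero] at hxy
    exact hx (norm_eq_zero.mp hxy.symm)
  exact ⟨hne, ((norm_eq_norm_iff_valuation_eq hne hx).mp hxy.symm)⟩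

/-- `‖x‖ < 1 ↔ x = 0 ∨ 1 ≤ v(x)` on `ℚ_p`. [folklore] -/
theorem norm_lt_one_iff {x : ℚ_[p]} : ‖x‖ < 1 ↔ x = 0 ∨ 1 ≤ x.valuation := by
  rcases eq_or_ne x 0 with rfl | hx
  · simp
  · have h1 : (1 : ℝ) < p := by exact_mod_cast hp.out.one_lt
    rw [Padic.norm_eq_zpow_neg_valuation hx, ← zpow_zero (p : ℝ), zpow_lt_zpow_iff_right₀ h1]
    constructor
    · intro h; exact Or.inr (by omega)
    · rintro (h | h)
      · exact (hx h).elim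
      · omega

/-- `‖x‖ = 1 ↔ x ≠ 0 ∧ v(x) = 0` on `ℚ_p`. [folklore] -/
theorem norm_eq_one_iff {x : ℚ_[p]} : ‖x‖ = 1 ↔ x ≠ 0 ∧ x.valuation = 0 := by
  rcases eq_or_ne x 0 with rfl | hx
  · simp
  · have h1 : (1 : ℝ) < p := by exact_mod_cast hp.out.one_lt
    rw [Padic.norm_eq_zpow_neg_valuation hx, ← zpow_zero (p : ℝ),
      (zpow_right_injective₀ (zero_lt_one.trans h1) h1.ne').eq_iff]
    simp only [ne_eq, hx, not_false_eq_true, true_and]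
    omega

/-- For non-zero `x, y ∈ ℚ_p`: `‖y‖ ≤ ‖x‖ ↔ v(x) ≤ v(y)`. [folklore] -/
theorem norm_le_norm_iff_valuation_le {x y : ℚ_[p]} (hx : x ≠ 0) (hy : y ≠ 0) :
    ‖y‖ ≤ ‖x‖ ↔ x.valuation ≤ y.valuation := by
  rw [Padic.norm_eq_zpow_neg_valuation hx, Padic.norm_eq_zpow_neg_valuation hy,
    zpow_le_zpow_iff_right₀ (by exact_mod_cast hp.out.one_lt)]
  omega

/-- `1 < ‖x‖ ↔ v(x) < 0` on `ℚ_p`. [folklore] -/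
theorem one_lt_norm_iff {x : ℚ_[p]} : 1 < ‖x‖ ↔ x.valuation < 0 := by
  rw [← not_le, Padic.norm_le_one_iff_val_nonneg, not_le]

end Valuation

/-! ## §2 The discriminant and `c₄` of the normal form pin `‖a₃‖ = 1`, `‖a₁‖ < 1` -/

/-- **END-1.** For the normal form `y² + a₁xy + a₃y = x³` over `ℚ₃` (`Δ = a₃³(a₁³ − 27a₃)`,
`c₄ = a₁(a₁³ − 24a₃)`): if `v₃(Δ) = 3` and `‖c₄‖ < 1` then `a₃` is a `3`-adic unit and `3 ∣ a₁`
(`‖a₁‖ < 1`).  Three-case valuation analysis; no integrality of `a₁, a₃` is assumed. [folklore] -/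
theorem norm_a₃_eq_one_and_norm_a₁_lt_one {a₁ a₃ : ℚ_[3]} (ha₃ : a₃ ≠ 0)
    (hΔ : (a₃ ^ 3 * (a₁ ^ 3 - 27 * a₃)).valuation = 3)
    (hc₄ : ‖a₁ * (a₁ ^ 3 - 24 * a₃)‖ < 1) : ‖a₃‖ = 1 ∧ ‖a₁‖ < 1 := by
  have hv3 : (3 : ℚ_[3]).valuation = 1 := by exact_mod_cast Padic.valuation_p (p := 3)
  have hv27 : (27 : ℚ_[3]).valuation = 3 := by
    rw [show (27 : ℚ_[3]) = (3 : ℚ_[3]) ^ 3 by norm_num, Padic.valuation_pow, hv3]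
    norm_num
  set D := a₁ ^ 3 - 27 * a₃ with hD
  have hD0 : D ≠ 0 := by
    intro h
    rw [h, mul_zero, Padic.valuation_zero] at hΔ
    norm_num at hΔ
  have hΔ' : 3 * a₃.valuation + D.valuation = 3 := by
    rw [Padic.valuation_mul (pow_ne_zero _ ha₃) hD0, Padic.valuation_pow] at hΔ
    push_cast at hΔ
    linarith
  have h27 : (-(27 * a₃)).valuation = 3 + a₃.valuation := by
    rw [valuation_neg', Padic.valuation_mul (by norm_num) ha₃, hv27]
  have h27ne : -(27 * a₃) ≠ 0 := neg_ne_zero.mpr (mul_ne_zero (by norm_num) ha₃)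
  have h3a : (3 * a₃).valuation = 1 + a₃.valuation := by
    rw [Padic.valuation_mul (by norm_num) ha₃, hv3]
  have h3ane : (3 : ℚ_[3]) * a₃ ≠ 0 := mul_ne_zero (by norm_num) ha₃
  have hDa : D = a₁ ^ 3 + -(27 * a₃) := by rw [hD]; ring
  have hCD : a₁ ^ 3 - 24 * a₃ = 3 * a₃ + D := by rw [hD]; ring
  -- conclusion in valuation form
  suffices H : a₃.valuation = 0 ∧ (a₁ = 0 ∨ 1 ≤ a₁.valuation) by
    exact ⟨norm_eq_one_iff.mpr ⟨ha₃, H.1⟩, norm_lt_one_iff.mpr H.2⟩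
  rcases eq_or_ne a₁ 0 with rfl | ha₁
  · -- `a₁ = 0`: `D = −27a₃`
    have hvD : D.valuation = 3 + a₃.valuation := by
      rw [hDa, zero_pow three_ne_zero, zero_add, h27]
    exact ⟨by omega, Or.inl rfl⟩
  · have hv13 : (a₁ ^ 3).valuation = 3 * a₁.valuation := by
      rw [Padic.valuation_pow]; push_cast; ring
    have ha13 : a₁ ^ 3 ≠ 0 := pow_ne_zero _ ha₁
    -- `‖c₄‖ < 1`: either `c₄ = 0` or `v(c₄) ≥ 1`
    rw [norm_lt_one_iff] at hc₄
    have hC0 : a₁ ^ 3 - 24 * a₃ ≠ 0 := by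
      intro hC
      -- then `D = −3a₃`, `v(D) = 1 + v(a₃)`, contradicting `3v(a₃) + v(D) = 3`
      have hD3 : D = -(3 * a₃) := by linear_combination hC - hCD
      have : D.valuation = 1 + a₃.valuation := by rw [hD3, valuation_neg', h3a]
      omega
    have hc₄' : 1 ≤ a₁.valuation + (a₁ ^ 3 - 24 * a₃).valuation := by
      rcases hc₄ with h | h
      · exact (mul_ne_zero ha₁ hC0 h).elim
      · rwa [Padic.valuation_mul ha₁ hC0] at h
    rcases lt_trichotomy (3 * a₁.valuation) (3 + a₃.valuation) with hlt | heq | hgt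
    · -- (i) `v(a₁³) < v(27a₃)`: `v(D) = 3v(a₁)`
      have hvD : D.valuation = 3 * a₁.valuation := by
        rw [hDa, (valuation_add_eq_left_of_lt 3 ha13 h27ne (by omega)).2, hv13]
      -- then `v(a₁) + v(a₃) = 1`; compare `v(3a₃) = 2 − v(a₁)` with `v(D) = 3v(a₁)`
      rcases le_or_gt a₁.valuation 0 with hle | hpos
      · have hvC : (a₁ ^ 3 - 24 * a₃).valuation = 3 * a₁.valuation := by
          rw [hCD, add_comm, (valuation_add_eq_left_of_lt 3 hD0 h3ane (by omega)).2, hvD]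
        omega
      · omega
    · -- (iii) equal valuations: `v(D) ≥ 3 + v(a₃)`
      have hvD : 3 + a₃.valuation ≤ D.valuation := by
        have := Padic.le_valuation_add (hDa ▸ hD0 : a₁ ^ 3 + -(27 * a₃) ≠ 0)
        rw [← hDa, hv13, h27, heq, min_self] at this
        exact this
      rcases eq_or_ne a₃.valuation 0 with h0 | h0
      · exact ⟨h0, Or.inr (by omega)⟩
      · -- `v(a₃) ≤ −3`: `v(C) = v(3a₃)` and `v(c₄) < 1`
        have hvC : (a₁ ^ 3 - 24 * a₃).valuation = 1 + a₃.valuation := by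
          rw [hCD, (valuation_add_eq_left_of_lt 3 h3ane hD0 (by omega)).2, h3a]
        omega
    · -- (ii) `v(27a₃) < v(a₁³)`: `v(D) = 3 + v(a₃)`, whence `v(a₃) = 0`, `v(a₁) ≥ 2`
      have hvD : D.valuation = 3 + a₃.valuation := by
        rw [hDa, add_comm, (valuation_add_eq_left_of_lt 3 h27ne ha13 (by omega)).2, h27]
      exact ⟨by omega, Or.inr (by omega)⟩

/-! ## §3 The FLAT half: every tangent value has valuation divisible by `3` -/

/-- **END-2 (the flat half of T29.6 in normal form).** If `a₃` is a `3`-adic unit and `a₁ ∈ ℤ₃`, then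
every affine point `(x, y)` of `y² + a₁xy + a₃y = x³` over `ℚ₃` with `x ≠ 0` has `y ≠ 0` and
`3 ∣ v₃(y)` — i.e. `y` has a FLAT (unit, "peu ramifié") cube class.  Valuation bookkeeping on
`y · (y + a₁x + a₃) = x³`; holds for Kodaira II and III alike. [folklore] -/
theorem ne_zero_and_three_dvd_valuation {a₁ a₃ x y : ℚ_[3]} (ha₃ : ‖a₃‖ = 1) (ha₁ : ‖a₁‖ ≤ 1)
    (h : y ^ 2 + a₁ * x * y + a₃ * y = x ^ 3) (hx : x ≠ 0) :
    y ≠ 0 ∧ (3 : ℤ) ∣ y.valuation := by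
  have hx3 : x ^ 3 ≠ 0 := pow_ne_zero _ hx
  have hy : y ≠ 0 := by
    rintro rfl
    exact hx3 (by linear_combination h.symm)
  refine ⟨hy, ?_⟩
  obtain ⟨ha₃0, hva₃⟩ := norm_eq_one_iff.mp ha₃
  -- `y · S = x³` with `S = y + (a₁ x + a₃)`
  set T := a₁ * x + a₃ with hT
  set S := y + T with hS
  have hyS : y * S = x ^ 3 := by rw [hS, hT]; linear_combination h
  have hS0 : S ≠ 0 := fun h0 => hx3 (by rw [← hyS, h0, mul_zero])
  have hvS : y.valuation + S.valuation = 3 * x.valuation := by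
    have := congrArg Padic.valuation hyS
    rwa [Padic.valuation_mul hy hS0, Padic.valuation_pow, Nat.cast_ofNat] at this
  -- norm bounds: `‖T‖ ≤ max ‖x‖ 1`, `‖S‖ ≤ max ‖y‖ (max ‖x‖ 1)`
  have hTle : ‖T‖ ≤ max ‖x‖ 1 := by
    refine (Padic.nonarchimedean _ _).trans (max_le_max ?_ ha₃.le)
    calc ‖a₁ * x‖ = ‖a₁‖ * ‖x‖ := norm_mul _ _
      _ ≤ 1 * ‖x‖ := by gcongr
      _ = ‖x‖ := one_mul _
  have hSle : ‖S‖ ≤ max ‖y‖ (max ‖x‖ 1) := (Padic.nonarchimedean _ _).trans (max_le_max le_rfl hTle)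
  -- if `‖T‖ < ‖y‖` then `v(S) = v(y)`
  have hvS_of_lt : ‖T‖ < ‖y‖ → S.valuation = y.valuation := fun hlt =>
    (add_ne_zero_and_valuation_add_eq_of_norm_lt hlt).2
  rcases lt_or_ge x.valuation 0 with hα | hα
  · -- (1) `v(x) < 0`, so `‖x‖ > 1` and `max ‖x‖ 1 = ‖x‖`
    have hx1 : 1 < ‖x‖ := one_lt_norm_iff.mpr hα
    have hm : max ‖x‖ 1 = ‖x‖ := max_eq_left hx1.le
    rw [hm] at hTle hSle
    rcases lt_or_ge y.valuation x.valuation with hβ | hβ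
    · -- `v(y) < v(x)`: `‖T‖ ≤ ‖x‖ < ‖y‖`, so `v(S) = v(y)` and `2 v(y) = 3 v(x)`
      have hyx : ‖x‖ < ‖y‖ := (norm_lt_norm_iff_valuation_lt hy hx).mpr hβ
      have := hvS_of_lt (hTle.trans_lt hyx)
      omega
    · -- `v(y) ≥ v(x)`: `‖S‖ ≤ ‖x‖`, so `v(S) ≥ v(x)`, forcing `v(x) ≥ 0`
      have hyx : ‖y‖ ≤ ‖x‖ := (norm_le_norm_iff_valuation_le hx hy).mpr hβ
      have hSx : ‖S‖ ≤ ‖x‖ := hSle.trans (max_le hyx le_rfl)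
      have := (norm_le_norm_iff_valuation_le hx hS0).mp hSx
      omega
  · -- (2) `v(x) ≥ 0`, so `max ‖x‖ 1 = 1`
    have hx1 : ‖x‖ ≤ 1 := (Padic.norm_le_one_iff_val_nonneg x).mpr hα
    have hm : max ‖x‖ 1 = 1 := max_eq_right hx1
    rw [hm] at hTle hSle
    rcases lt_trichotomy y.valuation 0 with hβ | hβ | hβ
    · -- `v(y) < 0`: `‖T‖ ≤ 1 < ‖y‖`, so `v(S) = v(y) < 0`, contradicting `2v(y) = 3v(x) ≥ 0`
      have := hvS_of_lt (hTle.trans_lt (one_lt_norm_iff.mpr hβ))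
      omega
    · simp [hβ]
    · -- `v(y) > 0`
      rcases eq_or_lt_of_le hα with hα0 | hαpos
      · -- `v(x) = 0`: `‖S‖ ≤ 1` gives `v(S) ≥ 0`, so `v(y) ≤ 0` — contradiction
        have hS1 : ‖S‖ ≤ 1 :=
          hSle.trans (max_le ((Padic.norm_le_one_iff_val_nonneg y).mpr hβ.le) le_rfl)
        have := (Padic.norm_le_one_iff_val_nonneg S).mp hS1
        omega
      · -- `v(x) ≥ 1`: `v(T) = 0` (the unit `a₃` dominates) and `v(S) = 0`, so `v(y) = 3 v(x)`
        have hxlt : ‖x‖ < 1 := norm_lt_one_iff.mpr (Or.inr (by omega))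
        have ha₁x : ‖a₁ * x‖ < ‖a₃‖ := by
          rw [ha₃, norm_mul]
          calc ‖a₁‖ * ‖x‖ ≤ 1 * ‖x‖ := by gcongr
            _ = ‖x‖ := one_mul _
            _ < 1 := hxlt
        have hT' := add_ne_zero_and_valuation_add_eq_of_norm_lt ha₁x
        rw [add_comm, ← hT] at hT'
        have hTn : ‖T‖ = 1 := norm_eq_one_iff.mpr ⟨hT'.1, hT'.2.trans hva₃⟩
        have hylt : ‖y‖ < ‖T‖ := hTn ▸ norm_lt_one_iff.mpr (Or.inr (by omega))
        have hS' := add_ne_zero_and_valuation_add_eq_of_norm_lt hylt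
        rw [add_comm, ← hS] at hS'
        have : S.valuation = 0 := hS'.2.trans (hT'.2.trans hva₃)
        exact ⟨x.valuation, by omega⟩

end Summit.BirchSwinnertonDyer.Rank1Residual.O5.ThreeTorsionNormalForm

end
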